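import Summits.QuantumFields.YangMills.Theses.OnsetSkewLaw
import Summits.QuantumFields.YangMills.Theorems.OnsetSkewLawOnsetSup
import Summits.QuantumFields.YangMills.Theorems.OnsetSkewLawRpSqContinuity
import HarnessLib

/-!
# Route `OnsetSkewLaw`, support `SkewFloorsGlue` (stmt-QuantumFields-23139) — BY NAME

`SkewVarianceLaw → PolynomialSeed → RPOnsetFloor → OnsetTautology.ComparableFloors` (LINE 2 of planner ym-idea-11, lens
«wuc»; K2 in its rev-1 «skewness non-degeneracy witness» form).  Proof (the item's plan, with the layer-2 lemma the route
thesis names — continuity/attainment of the onset — supplied by `OnsetSkewLawOnsetSup` / `OnsetSkewLawRpSqContinuity`):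

* `κ ≠ 0`: K2's witness `(β, μ, s)` satisfies K1's hypotheses (record factor `M`) and beats K1's error budget, so
  `κ·amp² ≠ 0`.
* With K1 at `M = 1` (constants `C, δ₀`) put `A := |κ|/(8(C+1))`, `ε := min ε₁ (min δ₀ A²)`, `s₀ := min 1 √(A√ε)`.
* Per `β ≥ β₅` and state `μ`: the onset set of level `ε` is non-empty (K3(i)) and `⊆ (0, s₀)` (K3(ii)); its supremum `ŝ`
  is ATTAINED with every square `≤ ε` at `ŝ` and `< ε` above (`onset_sSup_spec` + `continuousAt_rpSq`), hence
  `amp ŝ = ε` exactly and `amp s' ≤ amp ŝ` on `[ŝ, 1]`; K1 at `ŝ` gives `|Q3State ŝ| ≥ |κ|ε² − 2·|κ|ε²/8 ≥ |κ|ε²/2 =: ε₃`,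
  and `ComparableFloors` holds with `K = 1`, `s₃ = ŝ` (`floors_of_laws`, abstract real analysis).

THEOREMS ONLY.  Free-hands width seat `ym-line-sfw-p2-w4` (cell ym-idea-1).  R2a-IV RECORD-rung plumbing: no summit, rung
or crux (K1, K2, K3 stay open) is proved here and nothing about the Yang–Mills mass gap follows.
-/

set_option autoImplicit false

noncomputable section

open scoped BigOperators
open MeasureTheory Filter Topology
open Literature.MathematicalPhysics.QuantumFieldTheory Literature.MathematicalPhysics.QuantumLattice
open Summit.QuantumFields.YangMills.Theorems.InfiniteVolume (stateMomentStr Q3State)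
open Summit.QuantumFields.YangMills.Theorems.InfVolRP (centreOffset)

namespace Summit.QuantumFields.YangMills.Theorems.OnsetSkewLawGlue

/-! ## The abstract floor lemma (pure real analysis) -/

/-- **Floors from the laws (abstract).**  For squares `RP` jointly continuous in `(s, y)` on `s > 0`, a cumulant `Q3`, a
coefficient `κ ≠ 0` and K1-type control with error constant `C` below the ceiling `δ₀` at the record factor `1`: if the
level `ε ≤ δ₀` is small (`√ε ≤ |κ|/(8(C+1))`), the onset set of level `ε` is non-empty inside `(0, 1]` and every square is
`< ε` from the scale `s₀ ≤ 1` on (`s₀² ≤ |κ|√ε/(8(C+1))`), then at the attained onset supremum `ŝ` one has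
`|Q3 ŝ| ≥ |κ|ε²/2` and the whole onset set lies below `ŝ`. [folklore] -/
theorem floors_of_laws (RP : Fin 4 × Fin 4 → ℝ → EuclideanSpace ℝ (Fin 4) → ℝ) (Q3 : ℝ → ℝ)
    (κ C δ₀ ε s₀ : ℝ)
    (hcont : ∀ q, ∀ s : ℝ, 0 < s → ∀ y : EuclideanSpace ℝ (Fin 4),
      ContinuousAt (fun sy : ℝ × EuclideanSpace ℝ (Fin 4) => RP q sy.1 sy.2) (s, y))
    (hκ : κ ≠ 0) (hC : 0 ≤ C) (hε : 0 < ε) (hεδ : ε ≤ δ₀) (hεκ : Real.sqrt ε ≤ |κ| / (8 * (C + 1)))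
    (hs₀1 : s₀ ≤ 1) (hs₀κ : s₀ ^ 2 ≤ |κ| / (8 * (C + 1)) * Real.sqrt ε)
    (hK1 : ∀ s : ℝ, 0 < s → s ≤ 1 →
      (∀ s' : ℝ, s ≤ s' → s' ≤ 1 →
        (⨆ p : {p : (Fin 4 × Fin 4) × EuclideanSpace ℝ (Fin 4) // ∀ i, 0 ≤ p.2 i ∧ p.2 i ≤ s'}, RP p.1.1 s' p.1.2) ≤
          1 * ⨆ p : {p : (Fin 4 × Fin 4) × EuclideanSpace ℝ (Fin 4) // ∀ i, 0 ≤ p.2 i ∧ p.2 i ≤ s}, RP p.1.1 s p.1.2) →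
      (⨆ p : {p : (Fin 4 × Fin 4) × EuclideanSpace ℝ (Fin 4) // ∀ i, 0 ≤ p.2 i ∧ p.2 i ≤ s}, RP p.1.1 s p.1.2) ≤ δ₀ →
      |Q3 s - κ * (⨆ p : {p : (Fin 4 × Fin 4) × EuclideanSpace ℝ (Fin 4) // ∀ i, 0 ≤ p.2 i ∧ p.2 i ≤ s},
          RP p.1.1 s p.1.2) ^ 2| ≤
        C * ((⨆ p : {p : (Fin 4 × Fin 4) × EuclideanSpace ℝ (Fin 4) // ∀ i, 0 ≤ p.2 i ∧ p.2 i ≤ s}, RP p.1.1 s p.1.2) ^ 2 *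
            Real.sqrt (⨆ p : {p : (Fin 4 × Fin 4) × EuclideanSpace ℝ (Fin 4) // ∀ i, 0 ≤ p.2 i ∧ p.2 i ≤ s},
              RP p.1.1 s p.1.2) +
          s ^ 2 * ((⨆ p : {p : (Fin 4 × Fin 4) × EuclideanSpace ℝ (Fin 4) // ∀ i, 0 ≤ p.2 i ∧ p.2 i ≤ s},
              RP p.1.1 s p.1.2) *
            Real.sqrt (⨆ p : {p : (Fin 4 × Fin 4) × EuclideanSpace ℝ (Fin 4) // ∀ i, 0 ≤ p.2 i ∧ p.2 i ≤ s},
              RP p.1.1 s p.1.2))))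
    (hne : ∃ s : ℝ, 0 < s ∧ s ≤ 1 ∧ ∃ (q : Fin 4 × Fin 4) (y : EuclideanSpace ℝ (Fin 4)),
      (∀ i, 0 ≤ y i ∧ y i ≤ s) ∧ ε ≤ RP q s y)
    (hii : ∀ s : ℝ, s₀ ≤ s → ∀ (q : Fin 4 × Fin 4) (y : EuclideanSpace ℝ (Fin 4)), (∀ i, 0 ≤ y i ∧ y i ≤ s) → RP q s y < ε) :
    ∃ s₃ : ℝ, 0 < s₃ ∧ |κ| * ε ^ 2 / 2 ≤ |Q3 s₃| ∧
      ∀ s ∈ {s : ℝ | 0 < s ∧ ∃ (q : Fin 4 × Fin 4) (y : EuclideanSpace ℝ (Fin 4)),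
        (∀ i, 0 ≤ y i ∧ y i ≤ s) ∧ ε ≤ RP q s y}, s ≤ 1 * s₃ := by
  -- the onset set is non-empty and bounded by `s₀`
  have hne' : ∃ s, 0 < s ∧ ∃ (q : Fin 4 × Fin 4) (y : EuclideanSpace ℝ (Fin 4)), (∀ i, 0 ≤ y i ∧ y i ≤ s) ∧ ε ≤ RP q s y := by
    obtain ⟨s, hs, -, rest⟩ := hne
    exact ⟨s, hs, rest⟩
  have hbdd : ∀ s, (0 < s ∧ ∃ (q : Fin 4 × Fin 4) (y : EuclideanSpace ℝ (Fin 4)), (∀ i, 0 ≤ y i ∧ y i ≤ s) ∧ ε ≤ RP q s y) →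
      s ≤ s₀ := by
    rintro s ⟨-, q, y, hy, hε'⟩
    by_contra hlt
    rw [not_le] at hlt
    exact absurd hε' (not_le.mpr (hii s hlt.le q y hy))
  obtain ⟨hpos, ⟨q₀, y₀, hy₀, hatt⟩, hat_sup, habove, hle, hsup_le⟩ := onset_sSup_spec RP hcont ε s₀ hne' hbdd
  set S : ℝ := sSup {s | 0 < s ∧ ∃ (q : Fin 4 × Fin 4) (y : EuclideanSpace ℝ (Fin 4)),
    (∀ i, 0 ≤ y i ∧ y i ≤ s) ∧ ε ≤ RP q s y} with hS_def
  have hS1 : S ≤ 1 := hsup_le.trans hs₀1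
  -- the amplitude at `S` is exactly `ε`
  have hne_sub : ∀ t : ℝ, 0 ≤ t →
      Nonempty {p : (Fin 4 × Fin 4) × EuclideanSpace ℝ (Fin 4) // ∀ i, 0 ≤ p.2 i ∧ p.2 i ≤ t} :=
    fun t ht => ⟨⟨(((0 : Fin 4), (0 : Fin 4)), 0), fun i => ⟨le_rfl, by simpa using ht⟩⟩⟩
  have hampS : (⨆ p : {p : (Fin 4 × Fin 4) × EuclideanSpace ℝ (Fin 4) // ∀ i, 0 ≤ p.2 i ∧ p.2 i ≤ S}, RP p.1.1 S p.1.2) = ε := by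
    haveI := hne_sub S hpos.le
    refine le_antisymm (ciSup_le fun p => hat_sup p.1.1 p.1.2 p.2) ?_
    exact le_ciSup_of_le (bddAbove_range_box RP S (fun q y => hcont q S hpos y)) ⟨(q₀, y₀), hy₀⟩ hatt
  -- near-record with factor `1` on `[S, 1]`
  have hrec : ∀ s' : ℝ, S ≤ s' → s' ≤ 1 →
      (⨆ p : {p : (Fin 4 × Fin 4) × EuclideanSpace ℝ (Fin 4) // ∀ i, 0 ≤ p.2 i ∧ p.2 i ≤ s'}, RP p.1.1 s' p.1.2) ≤
        1 * ⨆ p : {p : (Fin 4 × Fin 4) × EuclideanSpace ℝ (Fin 4) // ∀ i, 0 ≤ p.2 i ∧ p.2 i ≤ S}, RP p.1.1 S p.1.2 := by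
    intro s' hs' _
    rw [one_mul, hampS]
    rcases eq_or_lt_of_le hs' with h | h
    · rw [← h, hampS]
    · haveI := hne_sub s' (hpos.le.trans hs')
      exact ciSup_le fun p => (habove s' h p.1.1 p.1.2 p.2).le
  -- K1 at `S`
  have hmain := hK1 S hpos hS1 hrec (by rw [hampS]; exact hεδ)
  rw [hampS] at hmain
  -- the two error terms are each `≤ |κ| ε² / 8`
  have hκpos : 0 < |κ| := abs_pos.mpr hκ
  have hA : 0 < |κ| / (8 * (C + 1)) := by positivity
  have hsqrt : 0 ≤ Real.sqrt ε := Real.sqrt_nonneg ε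
  have h1 : C * (ε ^ 2 * Real.sqrt ε) ≤ |κ| * ε ^ 2 / 8 := by
    have hC1 : C ≤ C + 1 := by linarith
    calc C * (ε ^ 2 * Real.sqrt ε) ≤ (C + 1) * (ε ^ 2 * (|κ| / (8 * (C + 1)))) := by
          apply mul_le_mul hC1 (mul_le_mul_of_nonneg_left hεκ (by positivity)) (by positivity) (by positivity)
      _ = |κ| * ε ^ 2 / 8 := by field_simp
  have h2 : C * (S ^ 2 * (ε * Real.sqrt ε)) ≤ |κ| * ε ^ 2 / 8 := by
    have hC1 : C ≤ C + 1 := by linarith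
    have hS2 : S ^ 2 ≤ |κ| / (8 * (C + 1)) * Real.sqrt ε := by
      have : S ^ 2 ≤ s₀ ^ 2 := pow_le_pow_left₀ hpos.le hsup_le 2
      exact this.trans hs₀κ
    calc C * (S ^ 2 * (ε * Real.sqrt ε)) ≤ (C + 1) * ((|κ| / (8 * (C + 1)) * Real.sqrt ε) * (ε * Real.sqrt ε)) := by
          apply mul_le_mul hC1 (mul_le_mul_of_nonneg_right hS2 (by positivity)) (by positivity) (by positivity)
      _ = |κ| * ε * (Real.sqrt ε * Real.sqrt ε) / 8 := by field_simp
      _ = |κ| * ε ^ 2 / 8 := by rw [Real.mul_self_sqrt hε.le]; ring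
  have herr : C * (ε ^ 2 * Real.sqrt ε + S ^ 2 * (ε * Real.sqrt ε)) ≤ |κ| * ε ^ 2 / 4 := by
    rw [mul_add]; linarith
  -- conclude
  refine ⟨S, hpos, ?_, fun s hs => by rw [one_mul]; exact hle s hs⟩
  have hkey : |κ * ε ^ 2| - |Q3 S| ≤ |Q3 S - κ * ε ^ 2| := by
    have := abs_sub_abs_le_abs_sub (κ * ε ^ 2) (Q3 S)
    rwa [abs_sub_comm] at this
  have hκε : |κ * ε ^ 2| = |κ| * ε ^ 2 := by rw [abs_mul, abs_of_nonneg (pow_nonneg hε.le 2)]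
  have hX : 0 ≤ |κ| * ε ^ 2 := by positivity
  have hchain : |κ * ε ^ 2| - |Q3 S| ≤ |κ| * ε ^ 2 / 4 := hkey.trans (hmain.trans herr)
  rw [hκε] at hchain
  linarith

/-! ## The glue, BY NAME -/

/-- **`SkewFloorsGlue`** (item stmt-QuantumFields-23139), BY NAME:
`SkewVarianceLaw → PolynomialSeed → RPOnsetFloor → OnsetTautology.ComparableFloors`, with `K = 1`, `ε₃ = |κ|ε²/2`,
`s₃ = ŝ` the attained onset supremum. [folklore] -/
theorem skewFloorsGlue_proof : Summit.QuantumFields.YangMills.Theses.OnsetSkewLaw.SkewFloorsGlue := by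
  intro hK1 hK2 hK3 G _ _ _ _ hG hSU
  letI : MeasurableSpace G := borel G
  haveI : BorelSpace G := ⟨rfl⟩
  -- K3: the bump, the level ceiling and the two onset clauses
  obtain ⟨r, b, hbc, hbs, hbi, hbperm, hbrefl, ε₁, hε₁, hK3'⟩ := hK3 G hG hSU
  -- K2 (witness form): the test functions and the record factor
  obtain ⟨f, g, h, t₁, t₂, M, hf, hg, hh, hM, hK2'⟩ := hK2 G hG hSU r b hbc hbs hbi
  -- K1: the coefficient
  obtain ⟨κ, hK1'⟩ := hK1 G hG hSU r b f g h hbc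
  -- κ ≠ 0
  have hκ : κ ≠ 0 := by
    intro hκ0
    obtain ⟨C, δ₀, β₀, _, hδ₀, hK1M⟩ := hK1' M hM
    obtain ⟨β, hβ, μ, hμ, hw⟩ := hK2' C δ₀ β₀ hδ₀
    have h1 := hK1M β hβ μ hμ
    dsimp only at h1 hw
    obtain ⟨s, hs0, hs1, hrec, hδ, hlt⟩ := hw
    have h2 := h1 s hs0 hs1 hrec hδ
    rw [hκ0, zero_mul, sub_zero] at h2
    exact absurd (lt_of_le_of_lt h2 hlt) (lt_irrefl _)
  -- K1 at the record factor 1, and the constants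
  obtain ⟨C, δ₀, β₀, hC, hδ₀, hK1one⟩ := hK1' 1 le_rfl
  have hκpos : 0 < |κ| := abs_pos.mpr hκ
  set A : ℝ := |κ| / (8 * (C + 1)) with hA_def
  have hA : 0 < A := by positivity
  set ε : ℝ := min ε₁ (min δ₀ (A ^ 2)) with hε_def
  have hε : 0 < ε := lt_min hε₁ (lt_min hδ₀ (by positivity))
  have hεε₁ : ε ≤ ε₁ := min_le_left _ _
  have hεδ : ε ≤ δ₀ := (min_le_right _ _).trans (min_le_left _ _)
  have hεA : Real.sqrt ε ≤ A := by
    rw [Real.sqrt_le_left hA.le]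
    exact (min_le_right _ _).trans (min_le_right _ _)
  set s₀ : ℝ := min 1 (Real.sqrt (A * Real.sqrt ε)) with hs₀_def
  have hs₀ : 0 < s₀ := lt_min one_pos (Real.sqrt_pos.mpr (mul_pos hA (Real.sqrt_pos.mpr hε)))
  have hs₀1 : s₀ ≤ 1 := min_le_left _ _
  have hs₀A : s₀ ^ 2 ≤ A * Real.sqrt ε := by
    have h1 : s₀ ≤ Real.sqrt (A * Real.sqrt ε) := min_le_right _ _
    have h2 : s₀ ^ 2 ≤ Real.sqrt (A * Real.sqrt ε) ^ 2 := pow_le_pow_left₀ hs₀.le h1 2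
    rwa [Real.sq_sqrt (by positivity)] at h2
  obtain ⟨⟨β₅, hK3i⟩, hK3ii⟩ := hK3' ε hε hεε₁
  obtain ⟨β₁, hK3ii'⟩ := hK3ii s₀ hs₀
  refine ⟨r, b, f, g, h, ε, |κ| * ε ^ 2 / 2, 1, max (max β₅ β₁) β₀, t₁, t₂, hbc, hbs, hbi, hbperm, hbrefl, hf, hg, hh,
    hε, by positivity, le_rfl, ?_⟩
  intro β hβ μ hμ
  have hβ₅ : β₅ ≤ β := ((le_max_left _ _).trans (le_max_left _ _)).trans hβ
  have hβ₁ : β₁ ≤ β := ((le_max_right _ _).trans (le_max_left _ _)).trans hβ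
  have hβ₀ : β₀ ≤ β := (le_max_right _ _).trans hβ
  have h1 := hK1one β hβ₀ μ hμ
  have h3i := hK3i β hβ₅ μ hμ
  have h3ii := hK3ii' β hβ₁ μ hμ
  dsimp only at h1 h3i h3ii ⊢
  exact floors_of_laws
    (fun (q : Fin 4 × Fin 4) (s : ℝ) (y : EuclideanSpace ℝ (Fin 4)) =>
      ∑' pp : ((Fin 4 × Fin 4) × (Fin 4 → ℤ)) × ((Fin 4 × Fin 4) × (Fin 4 → ℤ)),
        (if pp.1.1 ∈ ({q} : Finset (Fin 4 × Fin 4)) ∧ pp.1.1.1 < pp.1.1.2 then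
            b (timeReflection 4 (s • (siteToE pp.1.2 + centreOffset pp.1.1)) - y) else 0) *
          (if pp.2.1 ∈ ({q} : Finset (Fin 4 × Fin 4)) ∧ pp.2.1.1 < pp.2.1.2 then
            b (s • (siteToE pp.2.2 + centreOffset pp.2.1) - y) else 0) *
          stateMomentStr G r μ 2 ![pp.1.1, pp.2.1] ![pp.1.2, pp.2.2])
    (fun s => Q3State G r μ s f g h) κ C δ₀ ε s₀
    (fun q s hs y => continuousAt_rpSq r μ b b.continuous hbc {q} hs y)
    hκ hC hε hεδ hεA hs₀1 hs₀A h1 h3i h3ii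

end Summit.QuantumFields.YangMills.Theorems.OnsetSkewLawGlue

end
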